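import Summits.CriticalPhenomena.Ising3D.IsingColumnFaceL11CensusSigmaCellLin

/-!
# The `LIN` census of §7.3 on the certified `Δε` segment as kernel facts, I: vectors and bins
(cell `pub-ising3x`, seat recog-1; paper §7.1 / §7.3)

HONEST FRAMING: lottery ticket; floor = tightest certified 3D Ising CFT bounds; no exact-solution
claim without a proof. Island framing: certified exclusion region at stated derivative order and
assumptions; not a determination of the 3D Ising critical exponents beyond that.

Paper §7.3 prints, for the frozen family `LIN` = `linFamily 12` (`x = (a₀ + c₁π + c₂π² + c₃π³ +
c₄ log 2 + c₅ζ(3) + c₆ζ(5) + c₇G)/aₓ`, at most two `cᵢ ≠ 0`, `|cᵢ| ≤ 12`, `1 ≤ aₓ ≤ 12`, `a₀ ∈ ℤ` free),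
the CENSUS NUMBERS «short linear forms in classical constants 30 105 / 43 907 / 38 648» = the number of
the recogniser's DESCRIPTIONS (primitive tuples `(a₀, c, aₓ)`, `gcd(a₀, aₓ, c) = 1`) whose value lies in
the closed sub-windows `[81/64, 13/10]`, `[13/10, 27/20]`, `[27/20, 2855/2048]` of the certified segment;
§7.1 files them as «census numbers reproduced by independent implementations, not theorems». This module
and its companions `…SegmentLinCands.lean` (candidates, parts, the kernel check and its soundness) and
`…SegmentLinA/B/C.lean` (the seven kernel evaluations and the theorems) make them KERNEL FACTS by an
enumerate-and-decide machine: every tuple of the table whose value can lie in the segment is generated,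
its value is placed by the certified scaled-integer enclosures of the landed `LIN` checker
(`linZEncl` / `kZ`, scale `10¹⁸`, `ExclusionSentencesLin`) into one of the three sub-windows — strictly
off the interior cut points `13/10`, `27/20` — or outside the segment, and the kernel verifies that no
candidate is undecided.  Here, part I (no heavy kernel evaluation):
* `iccList`, `loopNZL` (list twin of `loopNZ`, `mem_loopNZL_iff`), `linVecsFirst i` — the 12 264
  coefficient vectors by the index `i` of their first non-zero entry (`mem_linVecsFirst_iff`,
  `linTupleOK_of_mem_linVecsFirst`, `exists_mem_linVecsFirst_of_linTupleOK`: exactly the vectors of the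
  table `linTupleOK 12`);
* the cut points `segCutQ` / `segCut` (`81/64, 13/10, 27/20, 2855/2048`, scaled exactly by `10¹⁸`:
  `segCut_cast`), the bin `linBinOf` of a tuple and its SOUNDNESS `linBinOf_spec` (bin `0 / 1 / 2` ⇒ the
  value lies in that closed sub-window, strictly inside at the interior cuts; bin `3` ⇒ outside the
  segment), the primitivity predicate `linPrim`.
Pure arithmetic over landed definitions and certified enclosures; no certificate, no datum, no axiom of
the σ–ε system; nothing is recognised (§1.6: at these widths membership carries no evidential weight).
Python twin (same enclosures, same loops, same counts): recog-1 gen 51 `twin_lintrg.py`.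
lottery ticket; floor = tightest certified 3D Ising CFT bounds; no exact-solution claim without a proof.
-/

namespace Summit.CriticalPhenomena.Ising3D
namespace ColumnFaceL11
open Set Literature.MathematicalPhysics.QuantumFieldTheory.ConformalBootstrap3D

/-! ### Generic list helpers -/

/-- The integers of `[lo, hi]` in increasing order (empty when `hi < lo`). [folklore] -/
def iccList (lo hi : ℤ) : List ℤ := (List.range (hi + 1 - lo).toNat).map fun i : ℕ => lo + (i : ℤ)

/-- Membership in `iccList`. [folklore] -/
theorem mem_iccList {lo hi n : ℤ} : n ∈ iccList lo hi ↔ lo ≤ n ∧ n ≤ hi := by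
  unfold iccList
  rw [List.mem_map]
  constructor
  · rintro ⟨i, hi', rfl⟩
    rw [List.mem_range] at hi'
    omega
  · rintro ⟨h1, h2⟩
    exact ⟨(n - lo).toNat, List.mem_range.mpr (by omega), by omega⟩

/-- List version of `loopNZ` (`ExclusionSentencesPiFormsLin`): all completions of `acc` by `k` further
entries in `[−H, H]` with at most `bud` of them non-zero, in increasing lexicographic order. [folklore] -/
def loopNZL (H : ℤ) : ℕ → ℕ → List ℤ → List (List ℤ)
  | 0, _, acc => [acc]
  | k + 1, 0, acc => loopNZL H k 0 (acc ++ [0])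
  | k + 1, bud + 1, acc => (iccList (-H) H).flatMap fun v =>
      if v = 0 then loopNZL H k (bud + 1) (acc ++ [0]) else loopNZL H k bud (acc ++ [v])

/-- What `loopNZL` lists (both directions). [folklore] -/
theorem mem_loopNZL_iff {H : ℤ} (hH : 0 ≤ H) : ∀ (k bud : ℕ) (acc c : List ℤ),
    c ∈ loopNZL H k bud acc ↔ ∃ pre : List ℤ, pre.length = k ∧ (∀ y ∈ pre, -H ≤ y ∧ y ≤ H) ∧
      (pre.filter (· ≠ 0)).length ≤ bud ∧ c = acc ++ pre
  | 0, bud, acc, c => by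
      simp only [loopNZL, List.mem_singleton]
      constructor
      · rintro rfl
        exact ⟨[], rfl, by simp, by simp, by simp⟩
      · rintro ⟨pre, hlen, -, -, rfl⟩
        rw [List.eq_nil_of_length_eq_zero hlen, List.append_nil]
  | k + 1, 0, acc, c => by
      rw [loopNZL, mem_loopNZL_iff hH k 0 (acc ++ [0]) c]
      constructor
      · rintro ⟨pre, hlen, hb, hf, rfl⟩
        refine ⟨0 :: pre, by simp [hlen], ?_, by simpa using hf, by simp⟩
        intro y hy
        rcases List.mem_cons.mp hy with rfl | hy
        · exact ⟨by omega, hH⟩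
        · exact hb y hy
      · rintro ⟨pre, hlen, hb, hf, rfl⟩
        cases pre with
        | nil => simp at hlen
        | cons v pre' =>
          have hv : v = 0 := by
            by_contra hv
            rw [List.filter_cons_of_pos (by simpa using hv)] at hf
            simp at hf
          subst hv
          refine ⟨pre', by simpa using hlen, fun y hy => hb y (List.mem_cons_of_mem _ hy), ?_, by simp⟩
          simpa using hf
  | k + 1, bud + 1, acc, c => by
      rw [loopNZL, List.mem_flatMap]
      constructor
      · rintro ⟨v, hv, hc⟩
        rw [mem_iccList] at hv
        split_ifs at hc with h0
        · subst h0
          rw [mem_loopNZL_iff hH k (bud + 1) _ c] at hc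
          obtain ⟨pre, hlen, hb, hf, rfl⟩ := hc
          refine ⟨0 :: pre, by simp [hlen], ?_, by simpa using hf, by simp⟩
          intro y hy
          rcases List.mem_cons.mp hy with rfl | hy
          · exact ⟨by omega, hH⟩
          · exact hb y hy
        · rw [mem_loopNZL_iff hH k bud _ c] at hc
          obtain ⟨pre, hlen, hb, hf, rfl⟩ := hc
          refine ⟨v :: pre, by simp [hlen], ?_, ?_, by simp⟩
          · intro y hy
            rcases List.mem_cons.mp hy with rfl | hy
            · exact hv
            · exact hb y hy
          · rw [List.filter_cons_of_pos (by simpa using h0), List.length_cons]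
            omega
      · rintro ⟨pre, hlen, hb, hf, rfl⟩
        cases pre with
        | nil => simp at hlen
        | cons v pre' =>
          refine ⟨v, mem_iccList.mpr (hb v (by simp)), ?_⟩
          split_ifs with h0
          · subst h0
            rw [mem_loopNZL_iff hH k (bud + 1)]
            refine ⟨pre', by simpa using hlen, fun y hy => hb y (List.mem_cons_of_mem _ hy), ?_, by simp⟩
            rw [List.filter_cons_of_neg (by simp)] at hf
            exact hf
          · rw [mem_loopNZL_iff hH k bud]
            refine ⟨pre', by simpa using hlen, fun y hy => hb y (List.mem_cons_of_mem _ hy), ?_, by simp⟩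
            rw [List.filter_cons_of_pos (by simpa using h0), List.length_cons] at hf
            omega

/-! ### The coefficient vectors, by first non-zero index -/

/-- The `LIN` coefficient vectors (`H = 12`) whose FIRST non-zero entry sits at index `i`, with at most
one further non-zero entry (`i = 0, …, 6`; 3 480 / 2 904 / 2 328 / 1 752 / 1 176 / 600 / 24 vectors). [folklore] -/
def linVecsFirst (i : ℕ) : List (List ℤ) :=
  (iccList (-12) 12).flatMap fun v =>
    if v = 0 then [] else (loopNZL 12 (6 - i) 1 []).map fun rest => List.replicate i 0 ++ v :: rest

/-- What `linVecsFirst i` lists. [folklore] -/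
theorem mem_linVecsFirst_iff {i : ℕ} {c : List ℤ} : c ∈ linVecsFirst i ↔
    ∃ (v : ℤ) (rest : List ℤ), (-12 ≤ v ∧ v ≤ 12) ∧ v ≠ 0 ∧ rest.length = 6 - i ∧
      (∀ y ∈ rest, -12 ≤ y ∧ y ≤ 12) ∧ (rest.filter (· ≠ 0)).length ≤ 1 ∧
      c = List.replicate i 0 ++ v :: rest := by
  unfold linVecsFirst
  rw [List.mem_flatMap]
  constructor
  · rintro ⟨v, hv, hc⟩
    rw [mem_iccList] at hv
    split_ifs at hc with h0
    · simp at hc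
    · rw [List.mem_map] at hc
      obtain ⟨rest, hrest, rfl⟩ := hc
      obtain ⟨pre, hlen, hb, hf, hce⟩ := (mem_loopNZL_iff (by norm_num) _ _ _ _).mp hrest
      rw [List.nil_append] at hce
      subst hce
      exact ⟨v, _, hv, h0, hlen, hb, hf, rfl⟩
  · rintro ⟨v, rest, hv, h0, hlen, hb, hf, rfl⟩
    refine ⟨v, mem_iccList.mpr hv, ?_⟩
    rw [if_neg h0, List.mem_map]
    exact ⟨rest, (mem_loopNZL_iff (by norm_num) _ _ _ _).mpr ⟨rest, hlen, hb, hf, by simp⟩, rfl⟩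

/-- Index of the first non-zero entry of an integer list (its length if there is none). [folklore] -/
def firstNZ : List ℤ → ℕ
  | [] => 0
  | y :: ys => if y = 0 then firstNZ ys + 1 else 0

/-- `firstNZ (0…0 v rest) = #zeros` for `v ≠ 0`. [folklore] -/
theorem firstNZ_replicate_append (i : ℕ) {v : ℤ} (hv : v ≠ 0) (rest : List ℤ) :
    firstNZ (List.replicate i 0 ++ v :: rest) = i := by
  induction i with
  | zero => simp [firstNZ, hv]
  | succ n ih => simp [List.replicate_succ, firstNZ, ih]

/-- A listed vector has first non-zero index `i`. [folklore] -/
theorem firstNZ_of_mem_linVecsFirst {i : ℕ} {c : List ℤ} (h : c ∈ linVecsFirst i) : firstNZ c = i := by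
  obtain ⟨v, rest, -, h0, -, -, -, rfl⟩ := mem_linVecsFirst_iff.mp h
  exact firstNZ_replicate_append i h0 rest

/-- A listed vector (with `i ≤ 6`) and a denominator `aₓ ∈ [1, 12]` give a tuple of the table
`linFamily 12` (`linTupleOK`). [folklore] -/
theorem linTupleOK_of_mem_linVecsFirst {i : ℕ} (hi : i ≤ 6) {c : List ℤ} (h : c ∈ linVecsFirst i)
    {a0 : ℤ} {ax : ℕ} (hax1 : 1 ≤ ax) (hax2 : ax ≤ 12) : linTupleOK 12 (a0, c, ax) = true := by
  obtain ⟨v, rest, hv, h0, hlen, hb, hf, rfl⟩ := mem_linVecsFirst_iff.mp h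
  have hfilt : (List.replicate i (0 : ℤ) ++ v :: rest).filter (· ≠ 0) = v :: rest.filter (· ≠ 0) := by
    rw [filter_ne_zero_replicate_append, List.filter_cons_of_pos (by simpa using h0)]
  simp only [linTupleOK, Bool.and_eq_true, decide_eq_true_eq, List.all_eq_true]
  refine ⟨⟨⟨⟨⟨by simp [hlen]; omega, hax1⟩, hax2⟩, ?_⟩, ?_⟩, ?_⟩
  · intro y hy
    rcases List.mem_append.mp hy with hy | hy
    · rw [(List.mem_replicate.mp hy).2]; norm_num
    · rcases List.mem_cons.mp hy with rfl | hy
      · exact ⟨hv.1, hv.2⟩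
      · exact hb y hy
  · rw [hfilt, List.length_cons]; omega
  · intro e
    have hm : v ∈ List.replicate i (0 : ℤ) ++ v :: rest := by simp
    rw [e] at hm
    simp only [List.mem_cons, List.not_mem_nil, or_false, or_self] at hm
    exact h0 hm

/-- Conversely: every tuple of the table `linFamily 12` has its vector listed at its first non-zero
index `i ≤ 6`. [folklore] -/
theorem exists_mem_linVecsFirst_of_linTupleOK {e : ℤ × List ℤ × ℕ} (h : linTupleOK 12 e = true) :
    ∃ i, i ≤ 6 ∧ e.2.1 ∈ linVecsFirst i ∧ 1 ≤ e.2.2 ∧ e.2.2 ≤ 12 := by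
  obtain ⟨a0, c, ax⟩ := e
  simp only [linTupleOK, Bool.and_eq_true, decide_eq_true_eq, List.all_eq_true] at h
  obtain ⟨⟨⟨⟨⟨hlen, h1⟩, h2⟩, hb⟩, hnz⟩, hc0⟩ := h
  have hc0' : c ≠ List.replicate c.length 0 := by rw [hlen]; exact hc0
  obtain ⟨i, v, rest, hsplit, hv⟩ := exists_first_ne_zero c hc0'
  have hlen' := congrArg List.length hsplit
  simp only [List.length_append, List.length_replicate, List.length_cons] at hlen'
  have hcb : ∀ y ∈ c, -(12 : ℤ) ≤ y ∧ y ≤ 12 := fun y hy => hb y hy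
  have hvb : -(12 : ℤ) ≤ v ∧ v ≤ 12 := hcb v (by rw [hsplit]; simp)
  have hrestb : ∀ y ∈ rest, -(12 : ℤ) ≤ y ∧ y ≤ 12 := fun y hy => hcb y (by rw [hsplit]; simp [hy])
  have hrestnz : (rest.filter (· ≠ 0)).length ≤ 1 := by
    have e : c.filter (· ≠ 0) = v :: rest.filter (· ≠ 0) := by
      rw [hsplit, filter_ne_zero_replicate_append, List.filter_cons_of_pos (by simpa using hv)]
    rw [e, List.length_cons] at hnz
    omega
  refine ⟨i, by omega, ?_, h1, h2⟩
  exact mem_linVecsFirst_iff.mpr ⟨v, rest, hvb, hv, by omega, hrestb, hrestnz, hsplit⟩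

/-- A tuple of the table has `aₓ > 0`. [folklore] -/
theorem linTupleOK_ax_pos {H : ℕ} {a0 : ℤ} {c : List ℤ} {ax : ℕ} (h : linTupleOK H (a0, c, ax) = true) :
    0 < ax := by
  simp only [linTupleOK, Bool.and_eq_true, decide_eq_true_eq] at h
  obtain ⟨⟨⟨⟨⟨-, h1⟩, -⟩, -⟩, -⟩, -⟩ := h
  exact h1

/-! ### The cut points and the bin of a tuple (scaled-integer arithmetic, scale `10¹⁸`) -/

/-- The four cut points `81/64 < 13/10 < 27/20 < 2855/2048` of §7.3 (segment ends, sub-window ends);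
index `≥ 3` means `2855/2048`. [folklore] -/
def segCutQ : ℕ → ℚ
  | 0 => 81 / 64
  | 1 => 13 / 10
  | 2 => 27 / 20
  | _ + 3 => 2855 / 2048

/-- The cut points scaled by `10¹⁸`, as integer literals (exact: `segCut_cast`). [folklore] -/
def segCut : ℕ → ℤ
  | 0 => 1265625000000000000
  | 1 => 1300000000000000000
  | 2 => 1350000000000000000
  | _ + 3 => 1394042968750000000

/-- `segCut k = 10¹⁸ · segCutQ k` (in `ℝ`). [folklore] -/
theorem segCut_cast (k : ℕ) : ((segCut k : ℤ) : ℝ) = (linS : ℝ) * ((segCutQ k : ℚ) : ℝ) := by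
  match k with
  | 0 => norm_num [segCut, segCutQ, linS]
  | 1 => norm_num [segCut, segCutQ, linS]
  | 2 => norm_num [segCut, segCutQ, linS]
  | k + 3 => norm_num [segCut, segCutQ, linS]

/-- Classification of a candidate with `10¹⁸·aₓ·value ∈ [P, Q]` against scaled cut points
`C₀ < C₁ < C₂ < C₃` (already multiplied by `aₓ`): `0, 1, 2` = decidably inside the first / second / third
closed sub-window (and strictly off the interior cut points), `3` = decidably outside the segment,
`4` = undecided at this precision. [folklore] -/
def linBin (P Q C0 C1 C2 C3 : ℤ) : ℕ :=
  if Q < C0 || C3 < P then 3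
  else if C0 ≤ P && Q < C1 then 0
  else if C1 < P && Q < C2 then 1
  else if C2 < P && Q ≤ C3 then 2
  else 4

/-- `gcd` of the absolute values of a list of integers (`0` for the empty list). [folklore] -/
def gcdList : List ℤ → ℕ
  | [] => 0
  | y :: ys => Nat.gcd y.natAbs (gcdList ys)

/-- A `LIN` tuple `(a₀, c, aₓ)` is PRIMITIVE: `gcd(|a₀|, aₓ, |c₁|, …, |c₇|) = 1` — the recogniser's
normal form of a DESCRIPTION (FAMILIES-v1 `LIN`: «gcd of all coefficients 1»). [folklore] -/
def linPrim (e : ℤ × List ℤ × ℕ) : Bool := Nat.gcd (Nat.gcd e.1.natAbs e.2.2) (gcdList e.2.1) == 1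

/-- The bin of a tuple: `linBin` on its scaled-integer enclosure `10¹⁸·a₀ + linZEncl 0 c`. [folklore] -/
def linBinOf (e : ℤ × List ℤ × ℕ) : ℕ :=
  linBin ((linS : ℤ) * e.1 + (linZEncl 0 e.2.1).1) ((linS : ℤ) * e.1 + (linZEncl 0 e.2.1).2)
    (segCut 0 * (e.2.2 : ℤ)) (segCut 1 * (e.2.2 : ℤ)) (segCut 2 * (e.2.2 : ℤ)) (segCut 3 * (e.2.2 : ℤ))

/-- The scaled value of a tuple lies in its scaled-integer enclosure:
`P ≤ 10¹⁸·(a₀ + Σ cᵢKᵢ) ≤ Q`. [folklore] -/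
theorem lin_scaled_mem (a0 : ℤ) (c : List ℤ) :
    (((linS : ℤ) * a0 + (linZEncl 0 c).1 : ℤ) : ℝ) ≤ (linS : ℝ) * ((a0 : ℝ) + lin7Val 0 c) ∧
      (linS : ℝ) * ((a0 : ℝ) + lin7Val 0 c) ≤ (((linS : ℤ) * a0 + (linZEncl 0 c).2 : ℤ) : ℝ) := by
  obtain ⟨h1, h2⟩ := linZEncl_sound 0 c
  constructor
  · push_cast; nlinarith
  · push_cast; nlinarith

/-- Comparison lemmas: a decided scaled-integer inequality gives the real one. [folklore] -/
theorem lin_val_lt_cut {a0 : ℤ} {c : List ℤ} {ax : ℕ} (hax : 0 < ax) {k : ℕ}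
    (h : (linS : ℤ) * a0 + (linZEncl 0 c).2 < segCut k * (ax : ℤ)) :
    lin7TupleVal (a0, c, ax) < ((segCutQ k : ℚ) : ℝ) := by
  have hax' : (0 : ℝ) < ax := by exact_mod_cast hax
  have hS : (0 : ℝ) < linS := by norm_num [linS]
  have h' : ((((linS : ℤ) * a0 + (linZEncl 0 c).2 : ℤ) : ℝ)) < ((segCut k * (ax : ℤ) : ℤ) : ℝ) := by
    exact_mod_cast h
  rw [Int.cast_mul, segCut_cast, Int.cast_natCast] at h'
  have h2 := (lin_scaled_mem a0 c).2
  unfold lin7TupleVal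
  rw [div_lt_iff₀ hax']
  nlinarith

/-- See `lin_val_lt_cut`. [folklore] -/
theorem lin_val_le_cut {a0 : ℤ} {c : List ℤ} {ax : ℕ} (hax : 0 < ax) {k : ℕ}
    (h : (linS : ℤ) * a0 + (linZEncl 0 c).2 ≤ segCut k * (ax : ℤ)) :
    lin7TupleVal (a0, c, ax) ≤ ((segCutQ k : ℚ) : ℝ) := by
  have hax' : (0 : ℝ) < ax := by exact_mod_cast hax
  have hS : (0 : ℝ) < linS := by norm_num [linS]
  have h' : ((((linS : ℤ) * a0 + (linZEncl 0 c).2 : ℤ) : ℝ)) ≤ ((segCut k * (ax : ℤ) : ℤ) : ℝ) := by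
    exact_mod_cast h
  rw [Int.cast_mul, segCut_cast, Int.cast_natCast] at h'
  have h2 := (lin_scaled_mem a0 c).2
  unfold lin7TupleVal
  rw [div_le_iff₀ hax']
  nlinarith

/-- See `lin_val_lt_cut`. [folklore] -/
theorem lin_cut_lt_val {a0 : ℤ} {c : List ℤ} {ax : ℕ} (hax : 0 < ax) {k : ℕ}
    (h : segCut k * (ax : ℤ) < (linS : ℤ) * a0 + (linZEncl 0 c).1) :
    ((segCutQ k : ℚ) : ℝ) < lin7TupleVal (a0, c, ax) := by
  have hax' : (0 : ℝ) < ax := by exact_mod_cast hax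
  have hS : (0 : ℝ) < linS := by norm_num [linS]
  have h' : ((segCut k * (ax : ℤ) : ℤ) : ℝ) < ((((linS : ℤ) * a0 + (linZEncl 0 c).1 : ℤ) : ℝ)) := by
    exact_mod_cast h
  rw [Int.cast_mul, segCut_cast, Int.cast_natCast] at h'
  have h1 := (lin_scaled_mem a0 c).1
  unfold lin7TupleVal
  rw [lt_div_iff₀ hax']
  nlinarith

/-- See `lin_val_lt_cut`. [folklore] -/
theorem lin_cut_le_val {a0 : ℤ} {c : List ℤ} {ax : ℕ} (hax : 0 < ax) {k : ℕ}
    (h : segCut k * (ax : ℤ) ≤ (linS : ℤ) * a0 + (linZEncl 0 c).1) :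
    ((segCutQ k : ℚ) : ℝ) ≤ lin7TupleVal (a0, c, ax) := by
  have hax' : (0 : ℝ) < ax := by exact_mod_cast hax
  have hS : (0 : ℝ) < linS := by norm_num [linS]
  have h' : ((segCut k * (ax : ℤ) : ℤ) : ℝ) ≤ ((((linS : ℤ) * a0 + (linZEncl 0 c).1 : ℤ) : ℝ)) := by
    exact_mod_cast h
  rw [Int.cast_mul, segCut_cast, Int.cast_natCast] at h'
  have h1 := (lin_scaled_mem a0 c).1
  unfold lin7TupleVal
  rw [le_div_iff₀ hax']
  nlinarith

/-- **Soundness of the bins.** For a tuple with `aₓ > 0`: bin `0` ⇒ `81/64 ≤ v < 13/10`; bin `1` ⇒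
`13/10 < v < 27/20`; bin `2` ⇒ `27/20 < v ≤ 2855/2048`; bin `3` ⇒ `v ∉ [81/64, 2855/2048]`
(`v = lin7TupleVal e`). [folklore] -/
theorem linBinOf_spec (a0 : ℤ) (c : List ℤ) {ax : ℕ} (hax : 0 < ax) :
    (linBinOf (a0, c, ax) = 0 → ((segCutQ 0 : ℚ) : ℝ) ≤ lin7TupleVal (a0, c, ax) ∧
        lin7TupleVal (a0, c, ax) < ((segCutQ 1 : ℚ) : ℝ)) ∧
    (linBinOf (a0, c, ax) = 1 → ((segCutQ 1 : ℚ) : ℝ) < lin7TupleVal (a0, c, ax) ∧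
        lin7TupleVal (a0, c, ax) < ((segCutQ 2 : ℚ) : ℝ)) ∧
    (linBinOf (a0, c, ax) = 2 → ((segCutQ 2 : ℚ) : ℝ) < lin7TupleVal (a0, c, ax) ∧
        lin7TupleVal (a0, c, ax) ≤ ((segCutQ 3 : ℚ) : ℝ)) ∧
    (linBinOf (a0, c, ax) = 3 → lin7TupleVal (a0, c, ax) < ((segCutQ 0 : ℚ) : ℝ) ∨
        ((segCutQ 3 : ℚ) : ℝ) < lin7TupleVal (a0, c, ax)) := by
  unfold linBinOf linBin
  simp only
  split_ifs with h3 h0 h1 h2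
  · simp only [Bool.or_eq_true, decide_eq_true_eq] at h3
    refine ⟨fun h => absurd h (by norm_num), fun h => absurd h (by norm_num),
      fun h => absurd h (by norm_num), fun _ => ?_⟩
    rcases h3 with h3 | h3
    · exact Or.inl (lin_val_lt_cut hax h3)
    · exact Or.inr (lin_cut_lt_val hax h3)
  · simp only [Bool.and_eq_true, decide_eq_true_eq] at h0
    exact ⟨fun _ => ⟨lin_cut_le_val hax h0.1, lin_val_lt_cut hax h0.2⟩, fun h => absurd h (by norm_num),
      fun h => absurd h (by norm_num), fun h => absurd h (by norm_num)⟩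
  · simp only [Bool.and_eq_true, decide_eq_true_eq] at h1
    exact ⟨fun h => absurd h (by norm_num), fun _ => ⟨lin_cut_lt_val hax h1.1, lin_val_lt_cut hax h1.2⟩,
      fun h => absurd h (by norm_num), fun h => absurd h (by norm_num)⟩
  · simp only [Bool.and_eq_true, decide_eq_true_eq] at h2
    exact ⟨fun h => absurd h (by norm_num), fun h => absurd h (by norm_num),
      fun _ => ⟨lin_cut_lt_val hax h2.1, lin_val_le_cut hax h2.2⟩, fun h => absurd h (by norm_num)⟩
  · exact ⟨fun h => absurd h (by norm_num), fun h => absurd h (by norm_num),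
      fun h => absurd h (by norm_num), fun h => absurd h (by norm_num)⟩

end ColumnFaceL11
end Summit.CriticalPhenomena.Ising3D
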